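import Summits.AtomisticToContinuum.HydrodynamicLimit.Theorems.JParityClosureParityBandClosureWindowCovarianceIsotropyC
import Summits.AtomisticToContinuum.HydrodynamicLimit.Theorems.JParityClosureEmpiricalEnskogIdentity
import Literature.Analysis.FluidPDE.CollisionalTransferTimeDep
import HarnessLib

/-!
# Window covariance isotropy (crux `JParityClosure.ParityBandClosure`, stmt-AtomisticToContinuum-17608, line
# `transfer-weighted-parity-chain`, stub `stub_windowCovarianceIsotropy`) — helper D: collisional balance of the
# window record

WHAT.  The per-window balance test of `ParityStability` is passed with a defect `O(ε_N)` at fixed `r`: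
`|∫ (c(v′) + c(w′) − c(v) − c(w)) dκ_w| ≤ ε · (A + A′ · (ε/(N+1)) #{ordered contact events in [0, τ]})`
(`abs_balance_wrec_le`), `A, A′` depending on `r`, `τ`, `‖c‖_∞` and the energy per particle only.

HOW (no smoothing: the window weights are only Lipschitz, so the `C¹` empirical Enskog identity is replaced by a
direct summation by parts along the trajectory):
* §1 `abs_finsum_collisionJump_le` — for an observable `F s w` bounded by `B` whose value along every free flight
  issued from the trajectory is `L`-Lipschitz in time, the frozen-time jump sum over the collisions in `(a, b]`
  is at most `2B + L(b − a)` (induction on the number of collisions, splitting at the first one, exactly as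
  `IsHardSphereTrajectory.sub_eq_integral_add_finsum_collisionJump_td`).
* §2 the window observable `F s w = btent(s − t₀)(N+1)⁻¹ Σₖ cone(xₖ, x₀) c(vₖ)`: `B = r⁻²·3/(πr³)·‖c‖`,
  `L = ‖c‖(r⁻⁴·3/(πr³) + r⁻²·3/(πr⁴)·(1/2 + E/(N+1)))` (tent and cone Lipschitz moduli, mean speed `≤ 1/2 +`
  energy per particle).
* §3 its jump at a collision is the `cone`-weighted contact sum of `c(vᵢ) − c(vᵢ⁻)` over ORDERED pairs
  (`collisionJump_empirical_eq_contact_sum`); the balance integrand of `κ_w` is the pair sum of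
  `cone(xᵢ)[(c(vᵢ) − c(vᵢ⁻)) + (c(vⱼ) − c(vⱼ⁻))]`, whose second half is, after the swap `(i, j) ↔ (j, i)` of the
  symmetric contact relation, the first half with weight `cone(xⱼ)`, and `|cone(xⱼ) − cone(xᵢ)| ≤ 3/(πr⁴) · ε` at
  contact.  The factor `ε` between the `(N+1)⁻¹` of the observable and the `ε/(N+1)` of `κ_w` is the smallness.

REFERENCES.  H. Spohn, *Large Scale Dynamics of Interacting Particles* (1991), Part I §3.2 (3.3)–(3.8) (weak
balance laws along one trajectory); N. N. Bogolyubov, Theor. Math. Phys. 24 (1975) (microscopic Enskog identity).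
No named fact is invoked.
-/

noncomputable section

namespace Summit.AtomisticToContinuum.HydrodynamicLimit.Theorems.ParityBandClosureWindowCovariance

open scoped BigOperators Topology Classical MeasureTheory ENNReal InnerProductSpace
open Filter Set MeasureTheory Function Topology
open Literature.MathematicalPhysics.KineticTheory
open Literature.Analysis.FluidPDE
open Summit.AtomisticToContinuum.HydrodynamicLimit.Theorems.LocalSecondLawNegative (cone cone_nonneg cone_le
  continuous_cone integral_cone_le)

variable {N : ℕ}

/-! ## §1 Jump sums of Lipschitz-in-time observables -/

section Jump

variable {d : Type*} [Fintype d] {X : Type*} [TopologicalSpace X] [T2Space X] {n : ℕ}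
  {G : Geometry d X} {ε : ℝ} {γ : ℝ → Config n d X}

/-- **Summation by parts along a hard-sphere trajectory, Lipschitz form.**  If `|F s w| ≤ B` and the value of `F`
along every free flight issued from a point of the trajectory is `L`-Lipschitz in time, then for `a ≤ b`
`|F b (γ b) − F a (γ a) − Σᶠ_{t ∈ C ∩ (a,b]} jump_t| ≤ L (b − a)`. [folklore] -/
theorem abs_sub_sub_finsum_collisionJump_le (h : IsHardSphereTrajectory G ε n γ)
    (hG : ∀ x : X, Continuous (G.translate x)) {F : ℝ → Config n d X → ℝ} {L : ℝ}
    (hL : ∀ t₀ s s', |F s (freeFlight G (s - t₀) (γ t₀)) - F s' (freeFlight G (s' - t₀) (γ t₀))| ≤ L * |s - s'|)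
    {a b : ℝ} (hab : a ≤ b) :
    |F b (γ b) - F a (γ a) - ∑ᶠ t ∈ collisionTimes G ε γ ∩ Set.Ioc a b, collisionJump (F t) γ t| ≤ L * (b - a) := by
  classical
  suffices H : ∀ (m : ℕ) (a : ℝ), a ≤ b → (h.finite_collisionTimes_inter_Ioc a b).toFinset.card = m →
      |F b (γ b) - F a (γ a) - ∑ᶠ t ∈ collisionTimes G ε γ ∩ Set.Ioc a b, collisionJump (F t) γ t| ≤
        L * (b - a) from H _ a hab rfl
  intro m
  induction m with
  | zero =>
    intro a hab hcard
    rw [Finset.card_eq_zero] at hcard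
    have hfree : ∀ σ ∈ Set.Ioc a b, σ ∉ collisionTimes G ε γ := fun σ hσ hcol =>
      Finset.notMem_empty σ (hcard ▸ (Set.Finite.mem_toFinset _).2 ⟨hcol, hσ⟩)
    have hzero : (∑ᶠ t ∈ collisionTimes G ε γ ∩ Set.Ioc a b, collisionJump (F t) γ t) = 0 := by
      have : collisionTimes G ε γ ∩ Set.Ioc a b = ∅ :=
        Set.eq_empty_iff_forall_notMem.2 fun t ht => hfree t ht.2 ht.1
      rw [this, finsum_mem_empty]
    have hγb : γ b = freeFlight G (b - a) (γ a) := h.eq_freeFlight hab hfree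
    have key := hL a b a
    rw [sub_self, freeFlight_zero, abs_of_nonneg (sub_nonneg.2 hab)] at key
    rw [hzero, sub_zero, hγb]
    exact key
  | succ m ih =>
    intro a hab hcard
    set S := (h.finite_collisionTimes_inter_Ioc a b).toFinset with hS
    have hne : S.Nonempty := Finset.card_pos.1 (by omega)
    have hTmem : S.min' hne ∈ collisionTimes G ε γ ∩ Set.Ioc a b :=
      (Set.Finite.mem_toFinset _).1 (S.min'_mem hne)
    set T := S.min' hne with hT
    have haT : a < T := hTmem.2.1
    have hTb : T ≤ b := hTmem.2.2
    have hmemS : ∀ {σ}, σ ∈ collisionTimes G ε γ → a < σ → σ ≤ b → σ ∈ S := fun hσ haσ hσb =>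
      (Set.Finite.mem_toFinset _).2 ⟨hσ, haσ, hσb⟩
    have hfree : ∀ σ ∈ Set.Ioo a T, σ ∉ collisionTimes G ε γ := fun σ hσ hcol =>
      (not_lt.2 (S.min'_le σ (hmemS hcol hσ.1 (hσ.2.le.trans hTb)))) hσ.2
    have hcard' : (h.finite_collisionTimes_inter_Ioc T b).toFinset.card = m := by
      have hE : (h.finite_collisionTimes_inter_Ioc T b).toFinset = S.erase T := by
        ext σ
        simp only [Set.Finite.mem_toFinset, Finset.mem_erase, Set.mem_inter_iff, Set.mem_Ioc]
        constructor
        · rintro ⟨hσ, hTσ, hσb⟩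
          exact ⟨hTσ.ne', hmemS hσ (haT.trans hTσ) hσb⟩
        · rintro ⟨hne', hσS⟩
          obtain ⟨hσ, haσ, hσb⟩ := (Set.Finite.mem_toFinset _).1 hσS
          exact ⟨hσ, lt_of_le_of_ne (S.min'_le σ hσS) (Ne.symm hne'), hσb⟩
      rw [hE, Finset.card_erase_of_mem (S.min'_mem hne), hcard]
      rfl
    have hIH := ih T hTb hcard'
    have hleft : leftLim γ T = freeFlight G (T - a) (γ a) := h.leftLim_eq_freeFlight hG haT hfree
    have hflight : |F T (leftLim γ T) - F a (γ a)| ≤ L * (T - a) := by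
      have key := hL a T a
      rw [sub_self, freeFlight_zero, abs_of_nonneg (sub_nonneg.2 haT.le)] at key
      rw [hleft]
      exact key
    rw [← h.finsum_collisionJump_td_add_adjacent F haT.le hTb,
      IsHardSphereTrajectory.finsum_collisionJump_td_eq F haT hTmem.1 hfree, collisionJump]
    have e : F b (γ b) - F a (γ a) - (F T (γ T) - F T (leftLim γ T) +
        ∑ᶠ t ∈ collisionTimes G ε γ ∩ Set.Ioc T b, collisionJump (F t) γ t) =
      (F b (γ b) - F T (γ T) - ∑ᶠ t ∈ collisionTimes G ε γ ∩ Set.Ioc T b, collisionJump (F t) γ t) +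
        (F T (leftLim γ T) - F a (γ a)) := by ring
    rw [e]
    refine (abs_add_le _ _).trans ?_
    nlinarith [hIH, hflight]

/-- **Jump sums of bounded Lipschitz-in-time observables are bounded**: `|Σᶠ_{(a,b]} jump_t| ≤ 2B + L(b − a)`.
[folklore] -/
theorem abs_finsum_collisionJump_le (h : IsHardSphereTrajectory G ε n γ)
    (hG : ∀ x : X, Continuous (G.translate x)) {F : ℝ → Config n d X → ℝ} {B L : ℝ} (hB : ∀ s w, |F s w| ≤ B)
    (hL : ∀ t₀ s s', |F s (freeFlight G (s - t₀) (γ t₀)) - F s' (freeFlight G (s' - t₀) (γ t₀))| ≤ L * |s - s'|)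
    {a b : ℝ} (hab : a ≤ b) :
    |∑ᶠ t ∈ collisionTimes G ε γ ∩ Set.Ioc a b, collisionJump (F t) γ t| ≤ 2 * B + L * (b - a) := by
  have h1 := abs_sub_sub_finsum_collisionJump_le h hG hL hab
  have h2 : |F b (γ b) - F a (γ a)| ≤ 2 * B := (abs_sub _ _).trans (by linarith [hB b (γ b), hB a (γ a)])
  set Sj := ∑ᶠ t ∈ collisionTimes G ε γ ∩ Set.Ioc a b, collisionJump (F t) γ t with hSj
  have h4 : |Sj| - |F b (γ b) - F a (γ a)| ≤ |F b (γ b) - F a (γ a) - Sj| := by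
    rw [abs_sub_comm (F b (γ b) - F a (γ a)) Sj]
    exact abs_sub_abs_le_abs_sub _ _
  linarith

end Jump

/-! ## §2 The window observable -/

/-- The window observable `F s w = (btent(s − t₀)/(N+1)) Σₖ cone(xₖ, x₀) c(vₖ)` whose jumps are the balance
integrand of the window record. [folklore] -/
def balObs (r t₀ : ℝ) (x₀ : T3) (c : V3 → ℝ) (s : ℝ) (w : Config (N + 1) (Fin 3) T3) : ℝ :=
  btent r (s - t₀) * ((N + 1 : ℕ) : ℝ)⁻¹ * ∑ k, cone r (w k).1 x₀ * c (w k).2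

section Obs

variable {r t₀ : ℝ} {x₀ : T3} {c : V3 → ℝ} {Cc : ℝ}

/-- The cone-weighted mean of a bounded mark is bounded by `3/(πr³) · ‖c‖`. [folklore] -/
theorem abs_mean_cone_mul_le (hr : 0 < r) (hc : ∀ v, |c v| ≤ Cc) (x₀ : T3) (w : Config (N + 1) (Fin 3) T3) :
    |((N + 1 : ℕ) : ℝ)⁻¹ * ∑ k, cone r (w k).1 x₀ * c (w k).2| ≤ 3 / (Real.pi * r ^ 3) * Cc := by
  rw [abs_mul, abs_of_nonneg (by positivity : (0 : ℝ) ≤ ((N + 1 : ℕ) : ℝ)⁻¹)]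
  have h1 : |∑ k, cone r (w k).1 x₀ * c (w k).2| ≤ ∑ _k : Fin (N + 1), 3 / (Real.pi * r ^ 3) * Cc := by
    refine (Finset.abs_sum_le_sum_abs _ _).trans (Finset.sum_le_sum fun k _ => ?_)
    rw [abs_mul, abs_of_nonneg (cone_nonneg hr _ _)]
    exact mul_le_mul (cone_le_peak hr _ _) (hc _) (abs_nonneg _) (by positivity)
  refine (mul_le_mul_of_nonneg_left h1 (by positivity)).trans ?_
  rw [Finset.sum_const, Finset.card_univ, Fintype.card_fin, nsmul_eq_mul, ← mul_assoc,
    inv_mul_cancel₀ (by positivity), one_mul]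

/-- The window observable is bounded by `r⁻² · 3/(πr³) · ‖c‖`. [folklore] -/
theorem abs_balObs_le (hr : 0 < r) (hc : ∀ v, |c v| ≤ Cc) (s : ℝ) (w : Config (N + 1) (Fin 3) T3) :
    |balObs r t₀ x₀ c s w| ≤ (r ^ 2)⁻¹ * (3 / (Real.pi * r ^ 3) * Cc) := by
  unfold balObs
  rw [mul_assoc, abs_mul, abs_of_nonneg (btent_nonneg _ _)]
  exact mul_le_mul (btent_le _ _) (abs_mean_cone_mul_le hr hc x₀ w) (abs_nonneg _) (by positivity)

/-- Free flight on the torus moves a position by at most `|a − b| ‖v‖` between times `a` and `b`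
(minimal-image distance). [folklore] -/
theorem euclidDist_translate_translate_le (x : T3) (v : V3) (a b : ℝ) :
    Torus.euclidDist ((Torus.geometry (Fin 3)).translate x (a • v)) ((Torus.geometry (Fin 3)).translate x (b • v)) ≤
      |a - b| * ‖v‖ := by
  rw [Torus.geometry_translate, Torus.geometry_translate, Torus.euclidDist_eq, add_sub_add_left_eq_sub,
    ← Torus.euclidDist_eq]
  refine (Torus.euclidDist_proj_le_norm_sub_holds _ _).trans ?_
  rw [← sub_smul, norm_smul, Real.norm_eq_abs]

/-- **The window observable is Lipschitz in time along free flights**, with constant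
`‖c‖ (r⁻⁴ · 3/(πr³) + r⁻² · 3/(πr⁴) · (1/2 + E/(N+1)))`. [folklore] -/
theorem abs_balObs_freeFlight_sub_le (hr : 0 < r) (hc : ∀ v, |c v| ≤ Cc) (z : Config (N + 1) (Fin 3) T3)
    (t₁ s s' : ℝ) :
    |balObs r t₀ x₀ c s (freeFlight (Torus.geometry (Fin 3)) (s - t₁) z) -
        balObs r t₀ x₀ c s' (freeFlight (Torus.geometry (Fin 3)) (s' - t₁) z)| ≤
      Cc * ((r ^ 2)⁻¹ * (r ^ 2)⁻¹ * (3 / (Real.pi * r ^ 3)) +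
        (r ^ 2)⁻¹ * (3 / (Real.pi * r ^ 4)) * (1 / 2 + ((N + 1 : ℕ) : ℝ)⁻¹ * configEnergy z)) * |s - s'| := by
  have hCc : 0 ≤ Cc := (abs_nonneg _).trans (hc 0)
  -- the two factors
  set A : ℝ → ℝ := fun u => btent r (u - t₀) with hA
  set M : ℝ → ℝ := fun u => ((N + 1 : ℕ) : ℝ)⁻¹ *
    ∑ k, cone r ((freeFlight (Torus.geometry (Fin 3)) (u - t₁) z) k).1 x₀ * c (z k).2 with hM
  have hF : ∀ u, balObs r t₀ x₀ c u (freeFlight (Torus.geometry (Fin 3)) (u - t₁) z) = A u * M u := by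
    intro u
    simp only [balObs, hA, hM, freeFlight_apply, mul_assoc]
  have hAb : ∀ u, |A u| ≤ (r ^ 2)⁻¹ := fun u => by
    rw [hA]; simp only []; rw [abs_of_nonneg (btent_nonneg _ _)]; exact btent_le _ _
  have hAl : |A s - A s'| ≤ (r ^ 2)⁻¹ * (r ^ 2)⁻¹ * |s - s'| := by
    have h := abs_btent_sub_le hr (s - t₀) (s' - t₀)
    rwa [sub_sub_sub_cancel_right] at h
  have hMb : ∀ u, |M u| ≤ 3 / (Real.pi * r ^ 3) * Cc := fun u => by
    have h := abs_mean_cone_mul_le hr hc x₀ (freeFlight (Torus.geometry (Fin 3)) (u - t₁) z)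
    simp only [freeFlight_apply] at h ⊢
    exact h
  have hMl : |M s - M s'| ≤ 3 / (Real.pi * r ^ 4) * Cc * (1 / 2 + ((N + 1 : ℕ) : ℝ)⁻¹ * configEnergy z) * |s - s'| := by
    have hms := KineticClosureBridge.meanSpeed_le z
    rw [hM]
    simp only [freeFlight_apply]
    rw [← mul_sub, ← Finset.sum_sub_distrib, abs_mul, abs_of_nonneg (by positivity : (0 : ℝ) ≤ ((N + 1 : ℕ) : ℝ)⁻¹)]
    have hk : ∀ k : Fin (N + 1),
        |cone r ((Torus.geometry (Fin 3)).translate (z k).1 ((s - t₁) • (z k).2)) x₀ * c (z k).2 -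
            cone r ((Torus.geometry (Fin 3)).translate (z k).1 ((s' - t₁) • (z k).2)) x₀ * c (z k).2| ≤
          3 / (Real.pi * r ^ 4) * Cc * |s - s'| * ‖(z k).2‖ := by
      intro k
      rw [← sub_mul, abs_mul]
      have h1 : |cone r ((Torus.geometry (Fin 3)).translate (z k).1 ((s - t₁) • (z k).2)) x₀ -
          cone r ((Torus.geometry (Fin 3)).translate (z k).1 ((s' - t₁) • (z k).2)) x₀| ≤
          3 / (Real.pi * r ^ 4) * (|s - s'| * ‖(z k).2‖) := by
        have h := gridUp_abs_cone_sub_cone_le hr ((Torus.geometry (Fin 3)).translate (z k).1 ((s - t₁) • (z k).2))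
          ((Torus.geometry (Fin 3)).translate (z k).1 ((s' - t₁) • (z k).2)) x₀
        refine h.trans (mul_le_mul_of_nonneg_left ?_ (by positivity))
        have h2 := euclidDist_translate_translate_le (z k).1 (z k).2 (s - t₁) (s' - t₁)
        rwa [sub_sub_sub_cancel_right] at h2
      calc _ ≤ 3 / (Real.pi * r ^ 4) * (|s - s'| * ‖(z k).2‖) * Cc :=
            mul_le_mul h1 (hc _) (abs_nonneg _) (by positivity)
        _ = _ := by ring
    calc ((N + 1 : ℕ) : ℝ)⁻¹ * |∑ k, (cone r ((Torus.geometry (Fin 3)).translate (z k).1 ((s - t₁) • (z k).2)) x₀ *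
            c (z k).2 - cone r ((Torus.geometry (Fin 3)).translate (z k).1 ((s' - t₁) • (z k).2)) x₀ * c (z k).2)|
        ≤ ((N + 1 : ℕ) : ℝ)⁻¹ * ∑ k, 3 / (Real.pi * r ^ 4) * Cc * |s - s'| * ‖(z k).2‖ :=
          mul_le_mul_of_nonneg_left ((Finset.abs_sum_le_sum_abs _ _).trans (Finset.sum_le_sum fun k _ => hk k))
            (by positivity)
      _ = 3 / (Real.pi * r ^ 4) * Cc * |s - s'| * (((N + 1 : ℕ) : ℝ)⁻¹ * ∑ k, ‖(z k).2‖) := by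
          rw [← Finset.mul_sum]; ring
      _ ≤ 3 / (Real.pi * r ^ 4) * Cc * |s - s'| * (1 / 2 + ((N + 1 : ℕ) : ℝ)⁻¹ * configEnergy z) :=
          mul_le_mul_of_nonneg_left hms (by positivity)
      _ = _ := by ring
  rw [hF, hF]
  have e : A s * M s - A s' * M s' = (A s - A s') * M s + A s' * (M s - M s') := by ring
  rw [e]
  refine (abs_add_le _ _).trans ?_
  rw [abs_mul (A s - A s') (M s), abs_mul (A s') (M s - M s')]
  have hE : 0 ≤ ((N + 1 : ℕ) : ℝ)⁻¹ * configEnergy z := by unfold configEnergy; positivity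
  have h1 : |A s - A s'| * |M s| ≤ (r ^ 2)⁻¹ * (r ^ 2)⁻¹ * |s - s'| * (3 / (Real.pi * r ^ 3) * Cc) :=
    mul_le_mul hAl (hMb s) (abs_nonneg _) (by positivity)
  have h2 : |A s'| * |M s - M s'| ≤
      (r ^ 2)⁻¹ * (3 / (Real.pi * r ^ 4) * Cc * (1 / 2 + ((N + 1 : ℕ) : ℝ)⁻¹ * configEnergy z) * |s - s'|) :=
    mul_le_mul (hAb s') hMl (abs_nonneg _) (by positivity)
  calc _ ≤ (r ^ 2)⁻¹ * (r ^ 2)⁻¹ * |s - s'| * (3 / (Real.pi * r ^ 3) * Cc) +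
        (r ^ 2)⁻¹ * (3 / (Real.pi * r ^ 4) * Cc * (1 / 2 + ((N + 1 : ℕ) : ℝ)⁻¹ * configEnergy z) * |s - s'|) :=
        add_le_add h1 h2
    _ = _ := by ring

end Obs

/-! ## §3 Jumps as contact sums; the swap of the symmetric contact relation -/

section Contact

variable {ε r τ t₀ : ℝ} {x₀ : T3} {γ : ℝ → Config (N + 1) (Fin 3) T3} {c : V3 → ℝ}

/-- **The jump sum of the window observable is a collision pair sum**: at each collision the frozen-time jump of
`balObs` is the `cone`-weighted ordered contact sum of `c(vᵢ) − c(vᵢ⁻)`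
(`collisionJump_empirical_eq_contact_sum`). [folklore] -/
theorem finsum_collisionJump_balObs_eq (hγ : IsHardSphereTrajectory (Torus.geometry (Fin 3)) ε (N + 1) γ)
    (S : Set ℝ) :
    (∑ᶠ t ∈ collisionTimes (Torus.geometry (Fin 3)) ε γ ∩ S, collisionJump (balObs r t₀ x₀ c t) γ t) =
      collisionPairSum (Torus.geometry (Fin 3)) ε γ S fun t i j =>
        btent r (t - t₀) * ((N + 1 : ℕ) : ℝ)⁻¹ * (cone r (γ t i).1 x₀ * (c (γ t i).2 -
          c (reflectVel ((Torus.geometry (Fin 3)).sepVec (γ t i).1 (γ t j).1) ((γ t i).2, (γ t j).2)).1)) := by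
  rw [collisionPairSum_eq_finsum_ite hγ.mem]
  refine finsum_mem_congr rfl fun t ht => ?_
  have h := collisionJump_empirical_eq_contact_sum hγ (btent r (t - t₀) * ((N + 1 : ℕ) : ℝ)⁻¹)
    (fun x => cone r x x₀) c ht.1
  unfold balObs
  rw [h, Finset.mul_sum]
  refine Finset.sum_congr rfl fun i _ => ?_
  rw [Finset.mul_sum]
  refine Finset.sum_congr rfl fun j _ => ?_
  rw [mul_ite, mul_zero]

/-- **Swapping the ordered pair in a collision pair sum** (regular geometry: the contact relation is symmetric).
[folklore] -/
theorem collisionPairSum_swap {d : Type*} [Fintype d] {X : Type*} [TopologicalSpace X] {n : ℕ} {M : Type*}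
    [AddCommMonoid M] {G : Geometry d X} {ε : ℝ} (hG : G.IsHardSphereRegular ε) (γ : ℝ → Config n d X)
    (S : Set ℝ) (g : ℝ → Fin n → Fin n → M) :
    collisionPairSum G ε γ S (fun t i j => g t j i) = collisionPairSum G ε γ S g := by
  unfold collisionPairSum
  refine finsum_mem_congr rfl fun t _ => ?_
  exact Finset.sum_equiv (Equiv.prodComm (Fin n) (Fin n)) (fun p => (swap_mem_contactPairs_iff hG).symm)
    (fun p _ => rfl)

/-- At a contact of the torus geometry (`ε < 1/2`), exchanging the two particles exchanges the two incoming
velocities. [folklore] -/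
theorem reflectVel_sepVec_swap (hε : ε < 2⁻¹) {x y : T3} (hxy : ‖(Torus.geometry (Fin 3)).sepVec x y‖ = ε)
    (v w : V3) :
    reflectVel ((Torus.geometry (Fin 3)).sepVec y x) (w, v) =
      ((reflectVel ((Torus.geometry (Fin 3)).sepVec x y) (v, w)).2,
        (reflectVel ((Torus.geometry (Fin 3)).sepVec x y) (v, w)).1) := by
  rw [(Torus.isHardSphereRegular_geometry hε).sepVec_comm x y hxy.le, reflectVel_neg]
  exact reflectVel_swap _ (v, w)

/-- **The balance integrand of the window record** as a collision pair sum over ordered contact pairs: post minus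
pre for BOTH partners, weighted by the cone at the FIRST partner. [folklore] -/
theorem integral_balance_wrec_eq (hγ : IsHardSphereTrajectory (Torus.geometry (Fin 3)) ε (N + 1) γ) (hε : 0 < ε)
    (hr : 0 < r) (c : V3 → ℝ) :
    ∫ q, (c (collide q.2 q.1).1 + c (collide q.2 q.1).2 - c q.1.1 - c q.1.2) ∂(wrec ε r τ t₀ x₀ γ) =
      ε / (N + 1 : ℝ) * collisionPairSum (Torus.geometry (Fin 3)) ε γ (Set.Icc 0 τ) (fun s i j =>
        btent r (s - t₀) * cone r (γ s i).1 x₀ *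
          ((c (γ s i).2 - c (reflectVel ((Torus.geometry (Fin 3)).sepVec (γ s i).1 (γ s j).1)
              ((γ s i).2, (γ s j).2)).1) +
            (c (γ s j).2 - c (reflectVel ((Torus.geometry (Fin 3)).sepVec (γ s i).1 (γ s j).1)
              ((γ s i).2, (γ s j).2)).2))) := by
  rw [integral_wrec hε.le hr (finite_collisionTimes_Icc hγ τ), smul_eq_mul]
  congr 1
  refine collisionPairSum_congr fun t _ p hp => ?_
  obtain ⟨_, hsep⟩ := (mem_contactPairs_iff_of_mem (hγ.mem t)).1 hp
  set sep := (Torus.geometry (Fin 3)).sepVec (γ t p.1).1 (γ t p.2).1 with hsepdef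
  have hsep0 : sep ≠ 0 := fun h0 => hε.ne' (by rw [← hsep, h0, norm_zero])
  have hn1 : ‖ε⁻¹ • sep‖ = 1 := by
    rw [norm_smul, norm_inv, Real.norm_eq_abs, abs_of_pos hε, hsep, inv_mul_cancel₀ hε.ne']
  have hunit : unitDir sep hsep0 = toSph (ε⁻¹ • sep) := by
    refine Subtype.ext ?_
    rw [coe_toSph hn1]
    show ‖sep‖⁻¹ • sep = ε⁻¹ • sep
    rw [hsep]
  have hrec : recPt ε (γ t) p.1 p.2 = (reflectVel sep ((γ t p.1).2, (γ t p.2).2), toSph (ε⁻¹ • sep)) := rfl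
  have hcoll : collide (toSph (ε⁻¹ • sep)) (reflectVel sep ((γ t p.1).2, (γ t p.2).2)) =
      ((γ t p.1).2, (γ t p.2).2) := by
    rw [reflectVel_eq_collide_unitDir sep hsep0, hunit, collide_collide]
  rw [smul_eq_mul, hrec]
  dsimp only
  rw [hcoll]
  ring

/-- **The second-partner half, swapped**: the pair sum of `cone(xᵢ)(c(vⱼ) − c(vⱼ⁻))` is the pair sum of
`cone(xⱼ)(c(vᵢ) − c(vᵢ⁻))` (torus, `ε < 1/2`). [folklore] -/
theorem collisionPairSum_secondHalf_eq (hγ : IsHardSphereTrajectory (Torus.geometry (Fin 3)) ε (N + 1) γ)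
    (hε2 : ε < 2⁻¹) (S : Set ℝ) (a : ℝ → ℝ) (c : V3 → ℝ) :
    collisionPairSum (Torus.geometry (Fin 3)) ε γ S (fun s i j => a s * cone r (γ s i).1 x₀ *
        (c (γ s j).2 - c (reflectVel ((Torus.geometry (Fin 3)).sepVec (γ s i).1 (γ s j).1)
          ((γ s i).2, (γ s j).2)).2)) =
      collisionPairSum (Torus.geometry (Fin 3)) ε γ S (fun s i j => a s * cone r (γ s j).1 x₀ *
        (c (γ s i).2 - c (reflectVel ((Torus.geometry (Fin 3)).sepVec (γ s i).1 (γ s j).1)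
          ((γ s i).2, (γ s j).2)).1)) := by
  rw [← collisionPairSum_swap (Torus.isHardSphereRegular_geometry hε2) γ S]
  refine collisionPairSum_congr fun t _ p hp => ?_
  obtain ⟨_, hsep⟩ := (mem_contactPairs_iff_of_mem (hγ.mem t)).1 hp
  rw [reflectVel_sepVec_swap hε2 hsep]

end Contact

/-- **Registered sub-goal `stub_wciFreeFlightDisplacement` (helper D of `stub_windowCovarianceIsotropy`): free
flight on the flat torus displaces a position by at most `|a − b| ‖v‖` in minimal-image distance** — the modulus
behind the Lipschitz-in-time summation by parts of the window observable. [folklore] -/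
theorem stub_wciFreeFlightDisplacement : ∀ (x : T3) (v : V3) (a b : ℝ), Torus.euclidDist ((Torus.geometry (Fin 3)).translate x (a • v)) ((Torus.geometry (Fin 3)).translate x (b • v)) ≤ |a - b| * ‖v‖ :=
  fun x v a b => euclidDist_translate_translate_le x v a b

end Summit.AtomisticToContinuum.HydrodynamicLimit.Theorems.ParityBandClosureWindowCovariance

end
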